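import Summits.ABC.ABC.Theorems.EisensteinQuarantine.Negative.EisensteinQuarantineFalseOfForcedPairDegreeDepthLaw
import Summits.ABC.ABC.Theorems.DefiniteXiEisensteinQuarantineForcedPairOccurrence
import HarnessLib

/-!
# Stub-ideation k2 (RESHAPE) — helper signatures for `stub_forcedPairOccurrence`
(crux stmt-ABC-15023 `EisensteinQuarantine`, line `forced-pair-dlog`, skeleton rev 5).

Scratch file of the ideator: every helper below ELABORATES; bodies are real proofs where they are pure
logic / arithmetic (adapters) — `lean check` rc 0, 0 sorries; the research cores are `def … : Prop`.  Nothing here is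
proposed to the tree by this seat —
the stub prover lands what it uses with `--supports stmt-ABC-15023`.
-/

set_option linter.dupNamespace false

namespace Summit.ABC.ABC.Cruxes.EisensteinQuarantine.ForcedPairDlog.StubIdeas2

open scoped BigOperators
open Literature.NumberTheory.Automorphic Literature.NumberTheory.EllipticCurves
open Summit.ABC.ABC.Theorems.EisensteinQuarantine.Negative
open Summit.ABC.ABC.Theorems

/-- The registered stub, verbatim (local name for readability of the helper signatures). -/
def Stub : Prop :=
  ∃ c : ℕ, ∀ q ℓ : ℕ, q.Prime → ℓ.Prime → q ≠ 2 → 32 * q ∣ ℓ - 1 →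
    ∀ N : ℕ, (freyCurve (-(ℓ : ℤ)) ((ℓ - 1 : ℕ) : ℤ)).conductorNorm ℤ = N →
    ∀ (S : Brandt.XiSetup (N / ℓ) ℓ) [Fintype (Brandt.ClassSet S.O)],
      ∀ φ : Brandt.ClassSet S.O → ℤ, φ ≠ 0 →
        Brandt.eigenLattice (N / ℓ * ℓ) (Brandt.matrix S.O)
            (fun n => (freyCurve (-(ℓ : ℤ)) ((ℓ - 1 : ℕ) : ℤ)).LFunction n) = ℤ ∙ φ →
        ∃ ψ : Brandt.ClassSet S.O → ℤ,
          ∑ i, (Brandt.weight S.O i : ℤ) * ψ i * φ i = 0 ∧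
            ∀ i, ((2 ^ ((q - 1).factorization 2 - c) : ℕ) : ℤ) ∣ φ i - ψ i

/-! ## H0 — the junk-free research core (Brandt currency, no setup / Fintype / line quantifiers) -/

/-- **H0 `ForcedPairXiDvd`**: `∃ c, ∀ forced (q, ℓ), 2^{v₂(q−1)−c} ∣ brandtXi (N/ℓ) ℓ (a(E_(−ℓ,ℓ−1)))`.
EQUIVALENT to the stub (H1, H1'), strictly WEAKER than `ForcedPairDepthLaw` (which in addition forces
`ξ ≠ 0`, i.e. the eigen-line, `isLine_of_forcedPairDepthLaw`). -/
def ForcedPairXiDvd : Prop :=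
  ∃ c : ℕ, ∀ q ℓ : ℕ, q.Prime → ℓ.Prime → q ≠ 2 → 32 * q ∣ ℓ - 1 →
    ∀ N : ℕ, (freyCurve (-(ℓ : ℤ)) ((ℓ - 1 : ℕ) : ℤ)).conductorNorm ℤ = N →
      2 ^ ((q - 1).factorization 2 - c) ∣
        brandtXi (N / ℓ) ℓ (fun n => (freyCurve (-(ℓ : ℤ)) ((ℓ - 1 : ℕ) : ℤ)).LFunction n)

/-- **H1** `ForcedPairXiDvd → Stub` (setup independence `Brandt.XiSetup.brandtXi_eq_xi` + the landed
dictionary `forcedPairOccurrence_of_dvd_xi`, p132787; same `c + 2`). -/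
theorem stub_of_xiDvd (h : ForcedPairXiDvd) : Stub := by
  obtain ⟨c, hc⟩ := h
  refine forcedPairOccurrence_of_dvd_xi ⟨c, fun q ℓ hq hℓ hq2 h32 N hN S _ φ _ _ => ?_⟩
  rw [← S.brandtXi_eq_xi]
  exact hc q ℓ hq hℓ hq2 h32 N hN

/-- **H1'** `Stub → ForcedPairXiDvd` (so H0 is an honest restatement, not a strengthening): off a line or
without a setup `brandtXi` is the junk value `0`. -/
theorem xiDvd_of_stub (h : Stub) : ForcedPairXiDvd := by
  obtain ⟨c, hc⟩ := h
  refine ⟨c, fun q ℓ hq hℓ hq2 h32 N hN => ?_⟩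
  by_cases hne : Nonempty (Brandt.XiSetup (N / ℓ) ℓ)
  · obtain ⟨S⟩ := hne
    letI : Fintype (Brandt.ClassSet S.O) := Fintype.ofFinite _
    by_cases hline : ∃ φ : Brandt.ClassSet S.O → ℤ, φ ≠ 0 ∧
        Brandt.eigenLattice (N / ℓ * ℓ) (Brandt.matrix S.O)
          (fun n => (freyCurve (-(ℓ : ℤ)) ((ℓ - 1 : ℕ) : ℤ)).LFunction n) = ℤ ∙ φ
    · obtain ⟨φ, hφ, hL⟩ := hline
      obtain ⟨ψ, hψ, hcong⟩ := hc q ℓ hq hℓ hq2 h32 N hN S φ hφ hL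
      rw [S.brandtXi_eq_xi]
      exact (dvd_xi_of_occurrence S _ hφ hL _ hψ hcong).1
    · rw [brandtXi_eq_zero_of_not_isLine S _ hline]; exact dvd_zero _
  · rw [brandtXi_of_isEmpty (not_nonempty_iff.mp hne)]; exact dvd_zero _

/-! ## Plan A — currency adapters: valuation law / degree law ⟹ stub -/

/-- **H2** (arithmetic): `2^j ≤ 2^c · ordProj[2] x → 2^{j−c} ∣ x` (for `x = 0` trivially). -/
theorem two_pow_sub_dvd_of_le_ordProj {j c x : ℕ} (h : 2 ^ j ≤ 2 ^ c * ordProj[2] x) :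
    2 ^ (j - c) ∣ x := by
  rcases eq_or_ne x 0 with rfl | hx
  · exact dvd_zero _
  · have hf : 2 ^ j ≤ 2 ^ (c + x.factorization 2) := by rwa [pow_add]
    have hjc : j ≤ c + x.factorization 2 := (Nat.pow_le_pow_iff_right (by norm_num)).mp hf
    exact (Nat.pow_dvd_pow 2 (by omega)).trans (Nat.ordProj_dvd x 2)

/-- **H3** `ForcedPairDepthLaw → ForcedPairXiDvd` (same `c`). -/
theorem xiDvd_of_forcedPairDepthLaw (h : ForcedPairDepthLaw) : ForcedPairXiDvd := by
  obtain ⟨c, hc⟩ := h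
  exact ⟨c, fun q ℓ hq hℓ hq2 h32 N hN => two_pow_sub_dvd_of_le_ordProj (hc q ℓ hq hℓ hq2 h32 N hN)⟩

/-- **A1** `ForcedPairDepthLaw → Stub` — the tree has only the converse direction
(`forcedPairDepthLaw_of_forcedPairOccurrence`, p134266, which needs rank one + modularity). -/
theorem stub_of_forcedPairDepthLaw (h : ForcedPairDepthLaw) : Stub :=
  stub_of_xiDvd (xiDvd_of_forcedPairDepthLaw h)

/-- **A2** degree currency: Takahashi Thm 2.3 + Frey modularity + `ForcedPairDegreeDepthLaw` ⟹ stub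
(through p135429 `forcedPairDepthLaw_of_degreeDepthLaw`).  `hMod` is the skeleton's own `stub_freyModularity`;
`hT` is a named-fact debt of the SAME dictionary as `stub_brandtEigenLatticeRankOne`. -/
theorem stub_of_degreeDepthLaw (hT : takahashi2001_thm_2_3)
    (hMod : Summit.ABC.ABC.Theses.DefiniteXi.FreyModularity) (hD : ForcedPairDegreeDepthLaw) : Stub :=
  stub_of_forcedPairDepthLaw (forcedPairDepthLaw_of_degreeDepthLaw hT hMod hD)

/-! ### A3 — third currency: the ARS congruence number `r_E` of `f_E` in `S₂(Γ₀(N), ℤ)` -/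

section CongruenceNumber
open Literature.NumberTheory.EllipticCurves.ModularForms

/-- **A3-core `ForcedPairCongruenceDepthLaw`** — `ForcedPairDegreeDepthLaw` with the optimal modular degree
replaced by the congruence number `r = congruenceNumber P.f` of the newform (ARS: the largest `r` with
`f ≡ g (mod r)` for some `g ∈ S₂(Γ₀(N), ℤ)` Petersson-orthogonal to `f`; tree `dvd_congruenceNumber_of_sub_eq_smul`
turns ONE exhibited congruence into `r ∣ congruenceNumber`).  The X₀(N)-side twin of the stub: `ψ ↔ g`,
`⟨·,·⟩_w ↔ Petersson`. NOT proved, NOT in print. -/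
def ForcedPairCongruenceDepthLaw : Prop :=
  ∃ c : ℕ, ∀ q ℓ : ℕ, q.Prime → ℓ.Prime → q ≠ 2 → 32 * q ∣ ℓ - 1 →
    ∀ (N : ℕ) [NeZero N], (freyCurve (-(ℓ : ℤ)) ((ℓ - 1 : ℕ) : ℤ)).conductorNorm ℤ = N →
    ∀ (W : WeierstrassCurve ℚ) [W.IsElliptic] (P : ModularParametrizationData W N),
      (∀ n : ℕ, W.LFunction n = (freyCurve (-(ℓ : ℤ)) ((ℓ - 1 : ℕ) : ℤ)).LFunction n) →
      (∀ (W' : WeierstrassCurve ℚ) [W'.IsElliptic] (P' : ModularParametrizationData W' N),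
          P'.f = P.f → P.modularDegree ≤ P'.modularDegree) →
      2 ^ ((q - 1).factorization 2) * ordProj[2] ((W.minimalDiscriminantNorm ℤ).factorization ℓ) ≤
        2 ^ c * ordProj[2] (congruenceNumber P.f)

/-- The forced conductor is not divisible by `4` (it is `rad(ℓ(ℓ−1))`: Serre normalisation
`freyCurve_serre_semistable`, domain facts verbatim from `dvd_conductorNorm_of_legendrePoint`). -/
theorem not_four_dvd_conductorNorm_of_legendrePoint {ℓ N : ℕ} (hℓ : ℓ.Prime) (h32 : 32 ∣ ℓ - 1)
    (hN : (freyCurve (-(ℓ : ℤ)) ((ℓ - 1 : ℕ) : ℤ)).conductorNorm ℤ = N) : ¬ 2 ^ 2 ∣ N := by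
  have hℓ1 : 1 ≤ ℓ := hℓ.one_lt.le
  have hM0 : ℓ - 1 ≠ 0 := by have := hℓ.two_le; omega
  have hℓcast : (ℓ : ℤ) = ((ℓ - 1 : ℕ) : ℤ) + 1 := by
    rw [Nat.cast_sub hℓ1]; push_cast; ring
  have hsum : -(ℓ : ℤ) + ((ℓ - 1 : ℕ) : ℤ) = -1 := by rw [hℓcast]; ring
  have habc : (-(ℓ : ℤ)) * ((ℓ - 1 : ℕ) : ℤ) * (-(ℓ : ℤ) + ((ℓ - 1 : ℕ) : ℤ)) =
      ((ℓ * (ℓ - 1) : ℕ) : ℤ) := by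
    rw [hsum]; push_cast; ring
  have h0 : (-(ℓ : ℤ)) * ((ℓ - 1 : ℕ) : ℤ) * (-(ℓ : ℤ) + ((ℓ - 1 : ℕ) : ℤ)) ≠ 0 := by
    rw [habc]; exact_mod_cast Nat.mul_ne_zero hℓ.ne_zero hM0
  have hab : IsCoprime (-(ℓ : ℤ)) ((ℓ - 1 : ℕ) : ℤ) := by
    rw [IsCoprime.neg_left_iff, Int.isCoprime_iff_gcd_eq_one, Int.gcd_natCast_natCast]
    exact (Nat.coprime_self_sub_right hℓ1).mpr (Nat.coprime_one_right ℓ)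
  have ha4 : (-(ℓ : ℤ)) ≡ -1 [ZMOD 4] := by
    have h4 : (4 : ℤ) ∣ ((ℓ - 1 : ℕ) : ℤ) := by exact_mod_cast (show (4 : ℕ) ∣ 32 by norm_num).trans h32
    have : (-(ℓ : ℤ)) = -1 - ((ℓ - 1 : ℕ) : ℤ) := by rw [hℓcast]; ring
    rw [this]
    calc -1 - ((ℓ - 1 : ℕ) : ℤ) ≡ -1 - 0 [ZMOD 4] :=
          Int.ModEq.sub_left _ ((Int.modEq_zero_iff_dvd).mpr h4)
      _ = -1 := by ring
  have hb32 : (32 : ℤ) ∣ ((ℓ - 1 : ℕ) : ℤ) := by exact_mod_cast h32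
  rw [← hN]
  exact freyCurve_serre_semistable hab h0 ha4 hb32 2 Nat.prime_two

/-- **A3** `ForcedPairCongruenceDepthLaw → ForcedPairDegreeDepthLaw` under the named fact ARS 2012 Thm 2.1(2)
(`padicValNat_congruenceNumber_eq_of_not_sq_dvd`: `ord_p r_E = ord_p m_E` when `p² ∤ N`; here `p = 2`, `4 ∤ N`). -/
theorem degreeDepthLaw_of_congruenceDepthLaw (hARS : padicValNat_congruenceNumber_eq_of_not_sq_dvd)
    (h : ForcedPairCongruenceDepthLaw) : ForcedPairDegreeDepthLaw := by
  obtain ⟨c, hc⟩ := h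
  refine ⟨c, fun q ℓ hq hℓ hq2 h32 N _ hN W _ P hLf hmin => ?_⟩
  have h4 : ¬ 2 ^ 2 ∣ N :=
    not_four_dvd_conductorNorm_of_legendrePoint hℓ ((Dvd.intro q rfl).trans h32) hN
  have hv : padicValNat 2 (congruenceNumber P.f) = padicValNat 2 P.modularDegree :=
    hARS W N P hmin 2 Nat.prime_two h4
  have hproj : ordProj[2] (congruenceNumber P.f) = ordProj[2] P.modularDegree := by
    rw [Nat.factorization_def _ Nat.prime_two, Nat.factorization_def _ Nat.prime_two, hv]
  rw [← hproj]
  exact hc q ℓ hq hℓ hq2 h32 N hN W P hLf hmin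

/-- **A3 ∘ A2**: ARS + Takahashi + modularity + the congruence-number law ⟹ stub. -/
theorem stub_of_congruenceDepthLaw (hARS : padicValNat_congruenceNumber_eq_of_not_sq_dvd)
    (hT : takahashi2001_thm_2_3) (hMod : Summit.ABC.ABC.Theses.DefiniteXi.FreyModularity)
    (h : ForcedPairCongruenceDepthLaw) : Stub :=
  stub_of_degreeDepthLaw hT hMod (degreeDepthLaw_of_congruenceDepthLaw hARS h)

end CongruenceNumber

/-! ## Plan C — weaken-and-bootstrap on the free constant `c` -/

/-- **C1** bootstrap: it suffices to treat partners `q ≡ 1 (mod 2^{j₀})` for any fixed `j₀` (cost `c ↦ c + j₀`;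
below `j₀` the modulus `2^{j−c−j₀}` is `1`).  E.g. `j₀ = 3`: `2` is a square mod `q`; `j₀ = 6`: census rows only. -/
theorem xiDvd_of_restricted (j₀ : ℕ)
    (h : ∃ c : ℕ, ∀ q ℓ : ℕ, q.Prime → ℓ.Prime → q ≠ 2 → 2 ^ j₀ ∣ q - 1 → 32 * q ∣ ℓ - 1 →
      ∀ N : ℕ, (freyCurve (-(ℓ : ℤ)) ((ℓ - 1 : ℕ) : ℤ)).conductorNorm ℤ = N →
        2 ^ ((q - 1).factorization 2 - c) ∣
          brandtXi (N / ℓ) ℓ (fun n => (freyCurve (-(ℓ : ℤ)) ((ℓ - 1 : ℕ) : ℤ)).LFunction n)) :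
    ForcedPairXiDvd := by
  obtain ⟨c, hc⟩ := h
  refine ⟨c + j₀, fun q ℓ hq hℓ hq2 h32 N hN => ?_⟩
  by_cases hj : 2 ^ j₀ ∣ q - 1
  · exact (Nat.pow_dvd_pow 2 (by omega)).trans (hc q ℓ hq hℓ hq2 hj h32 N hN)
  · have hqm1 : q - 1 ≠ 0 := by have := hq.two_le; omega
    have hlt : (q - 1).factorization 2 < j₀ :=
      lt_of_not_ge fun hle => hj ((Nat.prime_two.pow_dvd_iff_le_factorization hqm1).mpr hle)
    have h0 : (q - 1).factorization 2 - (c + j₀) = 0 := by omega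
    rw [h0, pow_zero]
    exact one_dvd _

/-- **C2** bootstrap on the cofactor: it suffices to treat `ℓ` large against `q` — any finite set of pairs is
absorbed into `c` only if the EXCLUDED set has bounded `v₂(q−1)`; the honest usable form is a side condition
that is eventually automatic along the supply, e.g. `q ^ 2 < ℓ` (true for `ℓ ≡ 1 (mod 32 q)`, `ℓ > 32 q`). -/
theorem xiDvd_of_sideCondition
    (h : ∃ c : ℕ, ∀ q ℓ : ℕ, q.Prime → ℓ.Prime → q ≠ 2 → 32 * q ∣ ℓ - 1 → 32 * q < ℓ →
      ∀ N : ℕ, (freyCurve (-(ℓ : ℤ)) ((ℓ - 1 : ℕ) : ℤ)).conductorNorm ℤ = N →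
        2 ^ ((q - 1).factorization 2 - c) ∣
          brandtXi (N / ℓ) ℓ (fun n => (freyCurve (-(ℓ : ℤ)) ((ℓ - 1 : ℕ) : ℤ)).LFunction n)) :
    ForcedPairXiDvd := by
  obtain ⟨c, hc⟩ := h
  refine ⟨c, fun q ℓ hq hℓ hq2 h32 N hN => hc q ℓ hq hℓ hq2 h32 ?_ N hN⟩
  -- `32 q ∣ ℓ − 1` and `0 < ℓ − 1` (ℓ prime) ⟹ `32 q ≤ ℓ − 1 < ℓ`
  have hℓ1 : 0 < ℓ - 1 := by have := hℓ.two_le; omega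
  have := Nat.le_of_dvd hℓ1 h32
  omega

/-! ## Insurance for the LEAD (not the stub): weaker laws that still build `ProthDepthFamily` -/

/-- **W1** supply-scoped law (quantified by the supply exponent `s`, conclusion `2^s`, not `2^{v₂(q−1)}`):
already builds `H`.  Use if the depth turns out to be driven by `min(s, ·)` rather than by `v₂(q−1)`. -/
theorem prothDepthFamily_of_supplyScopedLaw
    (hSup : ∃ A s₁ : ℕ, ∀ s : ℕ, s₁ ≤ s →
      ∃ q ℓ : ℕ, q.Prime ∧ ℓ.Prime ∧ 2 ^ s ∣ q - 1 ∧ 2 ^ s * q ∣ ℓ - 1 ∧ ℓ ≤ 2 ^ (A * s))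
    (hF : ∃ c : ℕ, ∀ s q ℓ : ℕ, q.Prime → ℓ.Prime → 5 ≤ s → 2 ^ s ∣ q - 1 → 2 ^ s * q ∣ ℓ - 1 →
      ∀ N : ℕ, (freyCurve (-(ℓ : ℤ)) ((ℓ - 1 : ℕ) : ℤ)).conductorNorm ℤ = N →
        2 ^ s ≤ 2 ^ c * ordProj[2] (brandtXi (N / ℓ) ℓ
          (fun n => (freyCurve (-(ℓ : ℤ)) ((ℓ - 1 : ℕ) : ℤ)).LFunction n))) :
    ProthDepthFamily := by
  obtain ⟨A, s₁, hAs⟩ := hSup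
  obtain ⟨c, hc⟩ := hF
  refine ⟨c, A, fun s₀ => ?_⟩
  obtain ⟨q, ℓ, hq, hℓ, hsq, hsl, hℓA⟩ := hAs (max s₀ (max s₁ 5)) ((le_max_left _ _).trans (le_max_right _ _))
  exact ⟨max s₀ (max s₁ 5), ℓ, le_max_left _ _, hℓ, (Dvd.intro q rfl).trans hsl, hℓA, fun N hN =>
    hc _ q ℓ hq hℓ ((le_max_right _ _).trans (le_max_right _ _)) hsq hsl N hN⟩

/-- **W2** lossy law (a fixed linear loss `j ↦ j / k` in the exponent) still builds `H` with `A ↦ A·k`: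
exponential-in-`s` depth against the polynomial allowance is all the kill p107816 uses. -/
theorem prothDepthFamily_of_lossyLaw
    (hSup : ∃ A s₁ : ℕ, ∀ s : ℕ, s₁ ≤ s →
      ∃ q ℓ : ℕ, q.Prime ∧ ℓ.Prime ∧ 2 ^ s ∣ q - 1 ∧ 2 ^ s * q ∣ ℓ - 1 ∧ ℓ ≤ 2 ^ (A * s))
    (hF : ∃ c k : ℕ, 0 < k ∧ ∀ q ℓ : ℕ, q.Prime → ℓ.Prime → q ≠ 2 → 32 * q ∣ ℓ - 1 →
      ∀ N : ℕ, (freyCurve (-(ℓ : ℤ)) ((ℓ - 1 : ℕ) : ℤ)).conductorNorm ℤ = N →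
        2 ^ ((q - 1).factorization 2 / k) ≤ 2 ^ c * ordProj[2] (brandtXi (N / ℓ) ℓ
          (fun n => (freyCurve (-(ℓ : ℤ)) ((ℓ - 1 : ℕ) : ℤ)).LFunction n))) :
    ProthDepthFamily := by
  obtain ⟨A, s₁, hAs⟩ := hSup
  obtain ⟨c, k, hk, hc⟩ := hF
  refine ⟨c, A * k, fun s₀ => ?_⟩
  -- run the supply at exponent `k · t`, `t := max s₀ s₁ 5`; the witness of the family is `(t, ℓ)`
  set t : ℕ := max s₀ (max s₁ 5) with ht
  have ht5 : 5 ≤ t := (le_max_right _ _).trans (le_max_right _ _)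
  have hts₁ : s₁ ≤ t := (le_max_left _ _).trans (le_max_right _ _)
  have hkt : t ≤ k * t := Nat.le_mul_of_pos_left t hk
  obtain ⟨q, ℓ, hq, hℓ, hsq, hsl, hℓA⟩ := hAs (k * t) (hts₁.trans hkt)
  have h32s : (32 : ℕ) ∣ 2 ^ (k * t) := by
    rw [show (32 : ℕ) = 2 ^ 5 by norm_num]; exact Nat.pow_dvd_pow 2 (ht5.trans hkt)
  have hq2 : q ≠ 2 := by
    intro h
    rw [h] at hsq
    have := Nat.le_of_dvd (by norm_num) (h32s.trans hsq)
    omega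
  have h32q : 32 * q ∣ ℓ - 1 := (Nat.mul_dvd_mul_right h32s q).trans hsl
  have h2tl : 2 ^ t ∣ ℓ - 1 := (Nat.pow_dvd_pow 2 hkt).trans ((Dvd.intro q rfl).trans hsl)
  refine ⟨t, ℓ, le_max_left _ _, hℓ, h2tl, ?_, fun N hN => ?_⟩
  · calc ℓ ≤ 2 ^ (A * (k * t)) := hℓA
      _ = 2 ^ (A * k * t) := by rw [mul_assoc]
  · have h := hc q ℓ hq hℓ hq2 h32q N hN
    have hqm1 : q - 1 ≠ 0 := by have := hq.two_le; omega
    have hsv : k * t ≤ (q - 1).factorization 2 :=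
      (Nat.prime_two.pow_dvd_iff_le_factorization hqm1).mp hsq
    have htk : t ≤ (q - 1).factorization 2 / k := by
      rw [Nat.le_div_iff_mul_le hk, mul_comm]; exact hsv
    exact (Nat.pow_le_pow_right (by norm_num) htk).trans h

end Summit.ABC.ABC.Cruxes.EisensteinQuarantine.ForcedPairDlog.StubIdeas2
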